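import Summits.CriticalPhenomena.PercolationContinuityZ3.Theorems.SahiAEOpenBandVersion
import Summits.CriticalPhenomena.PercolationContinuityZ3.Theorems.SahiAEZerosPrelim
import Summits.CriticalPhenomena.PercolationContinuityZ3.Theorems.SahiAESublatticeVersion

/-!
# THE STRUCTURE THEOREM FOR DENSITIES WITH ZEROS IN EVERY DIMENSION

Support file of the Sahi cell (`prim-sahi`, typer seat, generation 25; `--supports stmt-CriticalPhenomena-4575`).
Theorems only (no definitions, no named facts, no sorries).

`exists_measurable_tp2_version_of_ae_zeros` (every finite `ι`; `exists_measurable_tp2_version_of_ae_zeros'` is the case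
`|ι| ≥ 2`): **every measurable `f : ℝ^ι → [0,∞]` (`ι` finite), finite almost everywhere and MTP₂ on `λ ⊗ λ`-almost every
pair, has a Borel version `F = f` a.e., finite everywhere, with `F(x) F(y) ≤ F(x ∧ y) F(x ∨ y)` for ALL `x, y ∈ ℝ^ι`.**
Corollaries: `exists_tp2_density_of_isBoxTP2_zeros`, `isBoxTP2_iff_exists_tp2_density_zeros` (box-TP₂ laws with an
integrable density ⟺ an everywhere-TP₂ Borel density, every dimension, zeros allowed).  No
positivity and no bounds are assumed; the zero set is arbitrary.  This settles in every dimension the question left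
open in `main.tex` l.103 ("in dimension ≥ 3 the question remains open for densities with zeros"); the planar case is
`Plane.exists_measurable_tp2_version_of_ae_zeros` (generation 24), the zero-free case in every dimension
`exists_measurable_mtp2_version_of_ae_unbounded` (generation 23).

Proof.  Let `S = {f ≠ 0}` and `Xᵢ` the heights of its non-null hyperplane sections in direction `i`
(`secSupp`); `S ⊆ᵐ ∏ Xᵢ`.  Transport `⊗ λ|_{Xᵢ}` (equivalent to the product of the probability measures
`(λ|_{Xᵢ}).toFinite`) to Lebesgue measure on the open unit cube along the coordinatewise quantile maps (generation 21):
the transported density is a.e.-MTP₂ on the cube and its support is FULL — almost every hyperplane of the cube meets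
its honest sublattice version (`ae_hyperplane_meets`, `exists_measurable_sublattice_version_of_ae`).  By the support
theorem (`exists_isOpenBand_ae_eq`) the support is almost an OPEN BAND `B`, and THE BAND THEOREM IN EVERY DIMENSION
(`exists_measurable_tp2_version_of_ae_openBand`) gives an everywhere-MTP₂ Borel version of `𝟙_B g` on the cube;
pull it back along the coordinatewise distribution functions (a lattice homomorphism) and multiply by `𝟙_{∏ Xᵢ}`.
In dimension `≤ 1` every pair is comparable and the statement is trivial.  No sorries, no new axioms.
-/

noncomputable section

namespace Summit.CriticalPhenomena.PercolationContinuityZ3.Theorems.SahiAEFourFunctions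

open MeasureTheory Set Filter Topology Function ProbabilityTheory
open Summit.CriticalPhenomena.PercolationContinuityZ3.Theorems.SahiBoxTP2 (IsBoxTP2)
open scoped ENNReal NNReal

variable {ι : Type*} [Fintype ι] [DecidableEq ι]

omit [Fintype ι] [DecidableEq ι] in
/-- Product sets are sublattices. [folklore] -/
theorem inf_sup_mem_univ_pi {X : ι → Set ℝ} {x y : ι → ℝ} (hx : x ∈ Set.pi univ X) (hy : y ∈ Set.pi univ X) :
    x ⊓ y ∈ Set.pi univ X ∧ x ⊔ y ∈ Set.pi univ X := by
  rw [Set.mem_univ_pi] at hx hy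
  refine ⟨Set.mem_univ_pi.2 fun k => ?_, Set.mem_univ_pi.2 fun k => ?_⟩
  · simp only [Pi.inf_apply]
    rcases le_total (x k) (y k) with h | h
    · rw [min_eq_left h]; exact hx k
    · rw [min_eq_right h]; exact hy k
  · simp only [Pi.sup_apply]
    rcases le_total (x k) (y k) with h | h
    · rw [max_eq_right h]; exact hy k
    · rw [max_eq_left h]; exact hx k

/-- **THE STRUCTURE THEOREM FOR DENSITIES WITH ZEROS IN EVERY DIMENSION** (`|ι| ≥ 2`).  Every measurable
`f : ℝ^ι → [0,∞]`, almost everywhere finite and MTP₂ on Lebesgue-almost every pair, has a Borel, everywhere finite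
version `F` (`F = f` a.e.) with `F(x) F(y) ≤ F(x ∧ y) F(x ∨ y)` for ALL `x, y`. [this work] -/
theorem exists_measurable_tp2_version_of_ae_zeros' [Nontrivial ι] (f : (ι → ℝ) → ℝ≥0∞) (hf : Measurable f)
    (hfin : ∀ᵐ x ∂(volume : Measure (ι → ℝ)), f x ≠ ∞)
    (hMTP : ∀ᵐ q ∂(volume : Measure (ι → ℝ)).prod volume, f q.1 * f q.2 ≤ f (q.1 ⊓ q.2) * f (q.1 ⊔ q.2)) :
    ∃ F : (ι → ℝ) → ℝ≥0∞, Measurable F ∧ (∀ x, F x ≠ ∞) ∧ F =ᵐ[(volume : Measure (ι → ℝ))] f ∧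
      ∀ x y, F x * F y ≤ F (x ⊓ y) * F (x ⊔ y) := by
  classical
  -- the support and the heights of its non-null sections
  set S : Set (ι → ℝ) := {x | f x ≠ 0} with hS
  have mS : MeasurableSet S := (hf (measurableSet_singleton 0)).compl
  set X : ι → Set ℝ := fun k => secSupp S k with hXdef
  have mX : ∀ k, MeasurableSet (X k) := fun k => measurableSet_secSupp mS k
  have hSP : ∀ᵐ x ∂(volume : Measure (ι → ℝ)), x ∈ S → ∀ k, x k ∈ X k := by
    have h := ae_all_iff.2 fun k => ae_apply_mem_secSupp mS k
    filter_upwards [h] with x hx hxS k using hx k hxS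
  -- trivial case: some height set is null, and `f = 0` a.e.
  by_cases htriv : ∃ k, volume (X k) = 0
  · obtain ⟨k, hk⟩ := htriv
    have hf0 : f =ᵐ[(volume : Measure (ι → ℝ))] 0 := by
      have hP : ∀ᵐ x ∂(volume : Measure (ι → ℝ)), x k ∉ X k :=
        (SahiAESeparableTilt.quasiMeasurePreserving_eval (ι := ι) k).ae (measure_eq_zero_iff_ae_notMem.1 hk)
      filter_upwards [hSP, hP] with x hx hx'
      by_contra hne
      exact hx' (hx hne k)
    refine ⟨fun _ => 0, measurable_const, fun _ => ENNReal.zero_ne_top, hf0.symm, fun _ _ => by simp⟩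
  push Not at htriv
  -- the reference measures
  set ρ : ι → Measure ℝ := fun k => (volume : Measure ℝ).restrict (X k) with hρ
  haveI : ∀ k, NeZero (ρ k) := fun k => ⟨fun h => by
    have h' : (ρ k) univ = 0 := by rw [h]; rfl
    rw [hρ, Measure.restrict_apply_univ] at h'
    exact htriv k h'⟩
  set ν : ι → Measure ℝ := fun k => (ρ k).toFinite with hν
  haveI : ∀ k, IsProbabilityMeasure (ν k) := fun k => by rw [hν]; infer_instance
  haveI : ∀ k, NullSingletonClass (ν k) := fun k =>
    ⟨fun x => toFinite_absolutelyContinuous (ρ k) (measure_singleton x)⟩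
  set P : Set (ι → ℝ) := Set.pi univ X with hP
  have mP : MeasurableSet P := MeasurableSet.univ_pi mX
  have hpiρ : Measure.pi ρ = (volume : Measure (ι → ℝ)).restrict P := by
    rw [hP, volume_pi, Measure.restrict_pi_pi]
  have hρν : Measure.pi ρ ≪ Measure.pi ν := pi_absolutelyContinuous_pi_toFinite ρ
  have hνρ : Measure.pi ν ≪ Measure.pi ρ := pi_toFinite_absolutelyContinuous_pi ρ
  have hνvol : Measure.pi ν ≪ (volume : Measure (ι → ℝ)) :=
    hνρ.trans (by rw [hpiρ]; exact Measure.restrict_le_self.absolutelyContinuous)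
  -- the open unit cube and the transport maps
  set U : Set (ι → ℝ) := Set.pi univ fun _ => Ioo (0 : ℝ) 1 with hU
  have mU : MeasurableSet U := MeasurableSet.univ_pi fun _ => measurableSet_Ioo
  set μ₁ : Measure (ι → ℝ) := (volume : Measure (ι → ℝ)).restrict U with hμ₁
  have hμ₁pi : μ₁ = Measure.pi fun _ : ι => (volume : Measure ℝ).restrict (Ioo (0 : ℝ) 1) := by
    rw [hμ₁, hU, volume_pi, Measure.restrict_pi_pi]
  set T : (ι → ℝ) → (ι → ℝ) := fun u k => rqe (ν k) (u k) with hT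
  set R : (ι → ℝ) → (ι → ℝ) := fun x k => cdf (ν k) (x k) with hR
  have hTmp : MeasurePreserving T μ₁ (Measure.pi ν) := by
    rw [hμ₁pi]
    exact measurePreserving_pi _ _ fun k => measurePreserving_rqe (ν k)
  have hT_meas : Measurable T := hTmp.measurable
  have hR_meas : Measurable R :=
    measurable_pi_iff.2 fun k => (monotone_cdf (ν k)).measurable.comp (measurable_pi_apply k)
  have haeU : ∀ᵐ u ∂μ₁, u ∈ U := ae_restrict_mem mU
  have hRT : ∀ᵐ u ∂μ₁, R (T u) = u := by
    filter_upwards [haeU] with u hu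
    funext k
    have huk := Set.mem_univ_pi.1 hu k
    show cdf (ν k) (rqe (ν k) (u k)) = u k
    rw [rqe_of_mem _ huk, cdf_rq_eq _ huk]
  have hRlat : ∀ x y, R (x ⊓ y) = R x ⊓ R y ∧ R (x ⊔ y) = R x ⊔ R y := fun x y =>
    ⟨funext fun k => (monotone_cdf (ν k)).map_inf (x k) (y k),
      funext fun k => (monotone_cdf (ν k)).map_sup (x k) (y k)⟩
  have hTlat : ∀ x ∈ U, ∀ y ∈ U, T (x ⊓ y) = T x ⊓ T y ∧ T (x ⊔ y) = T x ⊔ T y := fun x hx y hy =>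
    ⟨funext fun k => (monotoneOn_rqe (ν k)).map_inf (Set.mem_univ_pi.1 hx k) (Set.mem_univ_pi.1 hy k),
      funext fun k => (monotoneOn_rqe (ν k)).map_sup (Set.mem_univ_pi.1 hx k) (Set.mem_univ_pi.1 hy k)⟩
  have hUinf : ∀ x ∈ U, ∀ y ∈ U, x ⊓ y ∈ U := isOpenBand_cube.inf_mem
  have hUsup : ∀ x ∈ U, ∀ y ∈ U, x ⊔ y ∈ U := isOpenBand_cube.sup_mem
  -- the transported density
  set g : (ι → ℝ) → ℝ≥0∞ := f ∘ T with hg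
  have hgm : Measurable g := hf.comp hT_meas
  have hqmp : Measure.QuasiMeasurePreserving T μ₁ (volume : Measure (ι → ℝ)) :=
    ⟨hT_meas, by rw [hTmp.map_eq]; exact hνvol⟩
  have hqmp2 := MeasureTheory.QuasiMeasurePreserving.prodMap hqmp hqmp
  have haeU2 : ∀ᵐ p ∂μ₁.prod μ₁, p.1 ∈ U ∧ p.2 ∈ U := by
    filter_upwards [(Measure.quasiMeasurePreserving_fst (μ := μ₁) (ν := μ₁)).ae haeU,
      (Measure.quasiMeasurePreserving_snd (μ := μ₁) (ν := μ₁)).ae haeU] with p h1 h2 using ⟨h1, h2⟩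
  have hgMTP : ∀ᵐ q ∂μ₁.prod μ₁, g q.1 * g q.2 ≤ g (q.1 ⊓ q.2) * g (q.1 ⊔ q.2) := by
    filter_upwards [hqmp2.ae hMTP, haeU2] with q hq hqU
    simp only [hg, Function.comp_apply, (hTlat q.1 hqU.1 q.2 hqU.2).1, (hTlat q.1 hqU.1 q.2 hqU.2).2]
    exact hq
  have hgfin : ∀ᵐ u ∂μ₁, g u ≠ ∞ := hqmp.ae hfin
  -- its support is an almost sublattice, a.e. equal to an honest one inside the cube
  set S' : Set (ι → ℝ) := {u | g u ≠ 0} with hS'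
  have mS' : MeasurableSet S' := (hgm (measurableSet_singleton 0)).compl
  have hae : ∀ᵐ p ∂(Measure.pi fun _ : ι => (volume : Measure ℝ).restrict (Ioo (0 : ℝ) 1)).prod
      (Measure.pi fun _ : ι => (volume : Measure ℝ).restrict (Ioo (0 : ℝ) 1)),
      p.1 ∈ S' → p.2 ∈ S' → p.1 ⊓ p.2 ∈ S' ∧ p.1 ⊔ p.2 ∈ S' := by
    rw [← hμ₁pi]
    filter_upwards [hgMTP] with p hp h1 h2
    have hL : g p.1 * g p.2 ≠ 0 := mul_ne_zero h1 h2
    have hR : g (p.1 ⊓ p.2) * g (p.1 ⊔ p.2) ≠ 0 := fun h => hL (le_zero_iff.1 (h ▸ hp))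
    exact ⟨(mul_ne_zero_iff.1 hR).1, (mul_ne_zero_iff.1 hR).2⟩
  obtain ⟨L₀, mL₀, -, hL₀ae, hL₀inf, hL₀sup⟩ :=
    exists_measurable_sublattice_version_of_ae (fun _ : ι => (volume : Measure ℝ).restrict (Ioo (0 : ℝ) 1)) mS' hae
  rw [← hμ₁pi] at hL₀ae
  set L : Set (ι → ℝ) := L₀ ∩ U with hL
  have mL : MeasurableSet L := mL₀.inter mU
  have hLU : L ⊆ U := Set.inter_subset_right
  have hLinf : ∀ x ∈ L, ∀ y ∈ L, x ⊓ y ∈ L := fun x hx y hy => ⟨hL₀inf hx.1 hy.1, hUinf x hx.2 y hy.2⟩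
  have hLsup : ∀ x ∈ L, ∀ y ∈ L, x ⊔ y ∈ L := fun x hx y hy => ⟨hL₀sup hx.1 hy.1, hUsup x hx.2 y hy.2⟩
  -- `L = S'` almost everywhere on the cube
  have hLS' : ∀ᵐ u ∂(volume : Measure (ι → ℝ)), u ∈ U → (u ∈ L ↔ u ∈ S') := by
    have h1 : ∀ᵐ u ∂μ₁, (u ∈ L₀ ↔ u ∈ S') := by
      filter_upwards [hL₀ae] with u hu
      exact ⟨fun h => by rwa [← show (u ∈ L₀) = (u ∈ S') from hu], fun h => by rwa [show (u ∈ L₀) = (u ∈ S') from hu]⟩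
    have h2 := (ae_restrict_iff' mU).1 h1
    filter_upwards [h2] with u hu huU
    rw [← hu huU]
    exact ⟨fun h => h.1, fun h => ⟨h, huU⟩⟩
  -- FULLNESS: almost every hyperplane of the cube meets `L`
  have hνX : ∀ k, ν k ≪ (volume : Measure ℝ).restrict (X k) := fun k => by
    rw [hν]; exact toFinite_absolutelyContinuous (ρ k)
  have hfull : ∀ k, ∀ᵐ s ∂(volume : Measure ℝ), s ∈ Ioo (0 : ℝ) 1 → ∃ z ∈ L, z k = s := fun k =>
    ae_hyperplane_meets mS htriv ν hνX hρν mL hLS' k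
  -- the open band
  obtain ⟨B, hB, hBU, hBL⟩ := exists_isOpenBand_ae_eq mL hLU hLinf hLsup hfull
  have hBS' : ∀ᵐ u ∂(volume : Measure (ι → ℝ)), u ∈ U → (u ∈ B ↔ g u ≠ 0) := by
    filter_upwards [hBL, hLS'] with u hu hu' huU
    rw [show (u ∈ B) = (u ∈ L) from hu]
    exact (hu' huU).trans Iff.rfl
  -- the band theorem for `𝟙_B g`
  set g' : (ι → ℝ) → ℝ≥0∞ := B.indicator g with hg'
  have hg'm : Measurable g' := hgm.indicator hB.isOpen.measurableSet
  have hgfin' : ∀ᵐ u ∂(volume : Measure (ι → ℝ)), u ∈ U → g u ≠ ∞ := (ae_restrict_iff' mU).1 hgfin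
  have hpos' : ∀ᵐ x ∂(volume : Measure (ι → ℝ)), x ∈ B → g' x ≠ 0 ∧ g' x ≠ ∞ := by
    filter_upwards [hBS', hgfin'] with x hx hx' hxB
    rw [hg', Set.indicator_of_mem hxB]
    exact ⟨(hx (hBU hxB)).1 hxB, hx' (hBU hxB)⟩
  have hzero' : ∀ᵐ x ∂(volume : Measure (ι → ℝ)), x ∉ B → g' x = 0 :=
    Eventually.of_forall fun x hx => Set.indicator_of_notMem hx _
  have hgMTP' : ∀ᵐ q ∂(volume : Measure (ι → ℝ)).prod volume,
      q.1 ∈ U → q.2 ∈ U → g q.1 * g q.2 ≤ g (q.1 ⊓ q.2) * g (q.1 ⊔ q.2) := by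
    have h := hgMTP
    rw [hμ₁, Measure.prod_restrict, ae_restrict_iff' (mU.prod mU)] at h
    filter_upwards [h] with q hq h1 h2 using hq ⟨h1, h2⟩
  have hMTP' : ∀ᵐ q ∂(volume : Measure (ι → ℝ)).prod volume,
      g' q.1 * g' q.2 ≤ g' (q.1 ⊓ q.2) * g' (q.1 ⊔ q.2) := by
    filter_upwards [hgMTP'] with q hq
    by_cases h1 : q.1 ∈ B
    · by_cases h2 : q.2 ∈ B
      · simp only [hg', Set.indicator_of_mem h1, Set.indicator_of_mem h2, Set.indicator_of_mem (hB.inf_mem _ h1 _ h2),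
          Set.indicator_of_mem (hB.sup_mem _ h1 _ h2)]
        exact hq (hBU h1) (hBU h2)
      · rw [hg', Set.indicator_of_notMem h2, mul_zero]; exact zero_le
    · rw [hg', Set.indicator_of_notMem h1, zero_mul]; exact zero_le
  obtain ⟨G, hGm, hGB, hGB', hGae, hGtp⟩ :=
    exists_measurable_tp2_version_of_ae_openBand hB g' hg'm hpos' hzero' hMTP'
  -- `G = g` almost everywhere on the cube
  have hGg : ∀ᵐ u ∂μ₁, G u = g u := by
    rw [hμ₁, ae_restrict_iff' mU]
    filter_upwards [hGae, hBS'] with u hu hu' huU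
    rw [hu, hg']
    by_cases huB : u ∈ B
    · rw [Set.indicator_of_mem huB]
    · rw [Set.indicator_of_notMem huB]
      have : ¬ g u ≠ 0 := fun h => huB ((hu' huU).2 h)
      exact (not_not.1 this).symm
  -- pull back along the distribution functions
  have hPinf : ∀ x ∈ P, ∀ y ∈ P, x ⊓ y ∈ P := fun x hx y hy => (inf_sup_mem_univ_pi hx hy).1
  have hPsup : ∀ x ∈ P, ∀ y ∈ P, x ⊔ y ∈ P := fun x hx y hy => (inf_sup_mem_univ_pi hx hy).2
  refine ⟨P.indicator (G ∘ R), (hGm.comp hR_meas).indicator mP, fun x => ?_, ?_, fun x y => ?_⟩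
  · by_cases hx : x ∈ P
    · rw [Set.indicator_of_mem hx, Function.comp_apply]
      by_cases hRx : R x ∈ B
      · exact (hGB _ hRx).2
      · rw [hGB' _ hRx]; exact ENNReal.zero_ne_top
    · rw [Set.indicator_of_notMem hx]; exact ENNReal.zero_ne_top
  · -- the version property
    have h1 : ∀ᵐ u ∂μ₁, G (R (T u)) = f (T u) := by
      filter_upwards [hGg, hRT] with u hu huR
      rw [huR, hu]; rfl
    have h2 : ∀ᵐ y ∂μ₁.map T, G (R y) = f y :=
      (ae_map_iff hT_meas.aemeasurable (measurableSet_eq_fun (hGm.comp hR_meas) hf)).2 h1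
    rw [hTmp.map_eq] at h2
    have h3 : ∀ᵐ y ∂(volume : Measure (ι → ℝ)).restrict P, G (R y) = f y := by
      rw [← hpiρ]; exact hρν.ae_le h2
    have h4 := (ae_restrict_iff' mP).1 h3
    filter_upwards [h4, hSP] with y hy hyS
    by_cases hyP : y ∈ P
    · rw [Set.indicator_of_mem hyP, Function.comp_apply, hy hyP]
    · rw [Set.indicator_of_notMem hyP]
      by_contra hne
      exact hyP (Set.mem_univ_pi.2 (hyS (Ne.symm hne)))
  · by_cases hx : x ∈ P
    · by_cases hy : y ∈ P
      · rw [Set.indicator_of_mem hx, Set.indicator_of_mem hy, Set.indicator_of_mem (hPinf x hx y hy),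
          Set.indicator_of_mem (hPsup x hx y hy)]
        simp only [Function.comp_apply]
        rw [(hRlat x y).1, (hRlat x y).2]
        exact hGtp (R x) (R y)
      · rw [Set.indicator_of_notMem hy, mul_zero]; exact zero_le
    · rw [Set.indicator_of_notMem hx, zero_mul]; exact zero_le

omit [Fintype ι] [DecidableEq ι] in
/-- In dimension `≤ 1` every pair is comparable and every function is modular. [folklore] -/
theorem inf_sup_eq_or_of_subsingleton [Subsingleton ι] (x y : ι → ℝ) :
    (x ⊓ y = x ∧ x ⊔ y = y) ∨ (x ⊓ y = y ∧ x ⊔ y = x) := by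
  rcases isEmpty_or_nonempty ι with hι | ⟨⟨i⟩⟩
  · left; constructor <;> funext k <;> exact (IsEmpty.false k).elim
  · rcases le_total (x i) (y i) with h | h
    · have hxy : x ≤ y := fun k => by rw [Subsingleton.elim k i]; exact h
      exact Or.inl ⟨inf_eq_left.2 hxy, sup_eq_right.2 hxy⟩
    · have hyx : y ≤ x := fun k => by rw [Subsingleton.elim k i]; exact h
      exact Or.inr ⟨inf_eq_right.2 hyx, sup_eq_left.2 hyx⟩

/-- **THE STRUCTURE THEOREM FOR DENSITIES WITH ZEROS, EVERY FINITE DIMENSION.**  Every measurable `f : ℝ^ι → [0,∞]`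
(`ι` finite), almost everywhere finite and MTP₂ on Lebesgue-almost every pair, has a Borel, everywhere finite
version `F` (`F = f` a.e.) with `F(x) F(y) ≤ F(x ∧ y) F(x ∨ y)` for ALL `x, y` (in dimension `≤ 1` the statement is
trivial: every pair is comparable). [this work] -/
theorem exists_measurable_tp2_version_of_ae_zeros (f : (ι → ℝ) → ℝ≥0∞) (hf : Measurable f)
    (hfin : ∀ᵐ x ∂(volume : Measure (ι → ℝ)), f x ≠ ∞)
    (hMTP : ∀ᵐ q ∂(volume : Measure (ι → ℝ)).prod volume, f q.1 * f q.2 ≤ f (q.1 ⊓ q.2) * f (q.1 ⊔ q.2)) :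
    ∃ F : (ι → ℝ) → ℝ≥0∞, Measurable F ∧ (∀ x, F x ≠ ∞) ∧ F =ᵐ[(volume : Measure (ι → ℝ))] f ∧
      ∀ x y, F x * F y ≤ F (x ⊓ y) * F (x ⊔ y) := by
  rcases subsingleton_or_nontrivial ι with hι | hι
  · refine ⟨fun x => if f x = ∞ then 0 else f x, Measurable.ite (hf (measurableSet_singleton _)) measurable_const hf,
      fun x => ?_, ?_, fun x y => ?_⟩
    · by_cases h : f x = ∞ <;> simp [h]
    · filter_upwards [hfin] with x hx
      simp [hx]
    · rcases inf_sup_eq_or_of_subsingleton x y with ⟨h1, h2⟩ | ⟨h1, h2⟩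
      · rw [h1, h2]
      · rw [h1, h2, mul_comm]
  · exact exists_measurable_tp2_version_of_ae_zeros' f hf hfin hMTP

/-! ### Corollaries: TP₂ laws on `ℝ^ι` -/

/-- **TP₂ laws on `ℝ^ι` have everywhere-TP₂ Borel densities (zeros allowed).**  If `f : ℝ^ι → [0,∞]` is measurable
and integrable and the law `λ · f` is TP₂ on closed boxes, then `λ · f = λ · F` for a Borel, everywhere-finite `F`
with `F(x) F(y) ≤ F(x ∧ y) F(x ∨ y)` at EVERY pair. [this work] -/
theorem exists_tp2_density_of_isBoxTP2_zeros (f : (ι → ℝ) → ℝ≥0∞) (hf : Measurable f)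
    (hint : ∫⁻ z, f z ∂(volume : Measure (ι → ℝ)) ≠ ∞)
    (h : IsBoxTP2 ((volume : Measure (ι → ℝ)).withDensity f)) :
    ∃ F : (ι → ℝ) → ℝ≥0∞, Measurable F ∧ (∀ x, F x ≠ ∞) ∧
      (volume : Measure (ι → ℝ)).withDensity F = (volume : Measure (ι → ℝ)).withDensity f ∧
      ∀ x y, F x * F y ≤ F (x ⊓ y) * F (x ⊔ y) := by
  have hae : ∀ᵐ p : (ι → ℝ) × (ι → ℝ) ∂((volume : Measure (ι → ℝ)).prod volume),
      f p.1 * f p.2 ≤ f (p.1 ⊓ p.2) * f (p.1 ⊔ p.2) := by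
    have h' := (isBoxTP2_withDensity_pi_iff_ae (fun _ : ι => (volume : Measure ℝ)) f hf
      (by rw [← volume_pi]; exact hint)).1 (by rw [← volume_pi]; exact h)
    rwa [← volume_pi] at h'
  have hfin : ∀ᵐ x ∂(volume : Measure (ι → ℝ)), f x ≠ ∞ := by
    filter_upwards [ae_lt_top hf hint] with x hx using hx.ne
  obtain ⟨F, hFm, hFb, hFf, hFmtp⟩ := exists_measurable_tp2_version_of_ae_zeros f hf hfin hae
  exact ⟨F, hFm, hFb, withDensity_congr_ae hFf, hFmtp⟩

/-- **Box-TP₂ ⟺ an everywhere-TP₂ Borel density, for EVERY law on `ℝ^ι` with an integrable density** (no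
positivity, any dimension). [this work] -/
theorem isBoxTP2_iff_exists_tp2_density_zeros (f : (ι → ℝ) → ℝ≥0∞) (hf : Measurable f)
    (hint : ∫⁻ z, f z ∂(volume : Measure (ι → ℝ)) ≠ ∞) :
    IsBoxTP2 ((volume : Measure (ι → ℝ)).withDensity f) ↔
      ∃ F : (ι → ℝ) → ℝ≥0∞, Measurable F ∧
        (volume : Measure (ι → ℝ)).withDensity F = (volume : Measure (ι → ℝ)).withDensity f ∧
        ∀ x y, F x * F y ≤ F (x ⊓ y) * F (x ⊔ y) := by
  refine ⟨fun h => ?_, fun ⟨F, hFm, hFeq, hFmtp⟩ => ?_⟩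
  · obtain ⟨F, hFm, -, hFeq, hFmtp⟩ := exists_tp2_density_of_isBoxTP2_zeros f hf hint h
    exact ⟨F, hFm, hFeq, hFmtp⟩
  · rw [← hFeq, volume_pi]
    exact isBoxTP2_withDensity_pi_of_ae (fun _ : ι => (volume : Measure ℝ)) F hFm
      (Eventually.of_forall fun p => hFmtp p.1 p.2)

end Summit.CriticalPhenomena.PercolationContinuityZ3.Theorems.SahiAEFourFunctions
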